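import Mathlib
import Literature.Topology.FourManifolds.CancellationModelFlow

/-!
# Linearised rigidity of the cone equation at linear cones: the dynamical core (K17)

Solo seat `solo-NavierStokesRegularity-informed`, session 11; companion of
`paper/axisymmetric-cones.md`, §4b, Proposition 10: the linearisation of the cone equation
`C + (C·∇)C + ∇π = 0`, `div C = 0` at a symmetric traceless linear cone `C₀ = Ah` has vorticity form
`(Ah·∇)ζ = (A - I)ζ`; along the linear flow `h ↦ e^{tA} h` each eigen-component `g(t) = ζ_i(e^{tA}h)`
solves `g' = (a_i - 1) g`. The fact certified here is the dynamical content of Proposition 10(a): such a `g`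
(`= g(0) e^{(a_i-1)t}`, a landed Literature lemma) vanishes if it is bounded on `ℝ` and `a_i ≠ 1` —
so off the strain resonance `1 ∈ spec A` every Lipschitz linearised perturbation is irrotational.
No new definitions.
-/

namespace Summit.NavierStokesRegularity.NavierStokesRegularity.Theorems

/- The solution formula `g t = g 0 * exp (c t)` for `g' = c g` is already landed as
`Literature.Topology.FourManifolds.eq_mul_exp_of_hasDerivAt_const_mul` (Milnor model flow); we reuse it. -/

/-- Proposition 10(a), dynamical core: a solution of `g' = c g` that is bounded on all of `ℝ` vanishes
identically when `c ≠ 0` (take `t → +∞` if `c > 0`, `t → -∞` if `c < 0`; here: one explicit `t`). -/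
theorem bounded_expODE_eq_zero {g : ℝ → ℝ} {c M : ℝ} (hg : ∀ t, HasDerivAt g (c * g t) t)
    (hc : c ≠ 0) (hM : ∀ t, |g t| ≤ M) : ∀ t, g t = 0 := by
  have key : g 0 = 0 := by
    by_contra h0
    have hpos : 0 < |g 0| := abs_pos.mpr h0
    have hM0 : 0 ≤ M := (abs_nonneg _).trans (hM 0)
    have hq : 0 < (M + 1) / |g 0| := div_pos (by linarith) hpos
    set t : ℝ := Real.log ((M + 1) / |g 0|) / c with ht
    have hct : c * t = Real.log ((M + 1) / |g 0|) := by
      rw [ht]; field_simp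
    have hexp : Real.exp (c * t) = (M + 1) / |g 0| := by
      rw [hct, Real.exp_log hq]
    have hbound := hM t
    rw [Literature.Topology.FourManifolds.eq_mul_exp_of_hasDerivAt_const_mul hg t, abs_mul,
      Real.abs_exp, hexp] at hbound
    have hval : |g 0| * ((M + 1) / |g 0|) = M + 1 := by
      field_simp
    linarith
  intro t
  rw [Literature.Topology.FourManifolds.eq_mul_exp_of_hasDerivAt_const_mul hg t, key, zero_mul]

/-- Proposition 10(b), the resonant case `c = 0`: the component is invariant along the flow. -/
theorem expODE_resonant_const {g : ℝ → ℝ} (hg : ∀ t, HasDerivAt g (0 * g t) t) (t : ℝ) :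
    g t = g 0 := by
  simpa using Literature.Topology.FourManifolds.eq_mul_exp_of_hasDerivAt_const_mul hg t

end Summit.NavierStokesRegularity.NavierStokesRegularity.Theorems
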